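import Summits.CriticalPhenomena.Ising3D.Control2DTaylorClosedForm
import Summits.CriticalPhenomena.Ising3D.TaylorQPolyParity
import Mathlib.Tactic.Linarith
import Mathlib.Tactic.Positivity
import Mathlib.Tactic.Ring
import HarnessLib

/-!
# The 2D derivative functional at `z = z̄ = 1/2`: the closed forms as binomial polynomials
(cell `pub-ising3x`, seat controls-1 gen 14; KERNEL PATH for the 2D γ (derivative-functional)
certificates, step 2b — CONTROL-ONLY)

HONEST FRAMING: lottery ticket; floor = tightest certified 3D Ising CFT bounds; no exact-solution
claim without a proof. CONTROL-ONLY (`d = 2`); nothing numerical is asserted here.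

`Control2DTaylorClosedForm` expresses the Taylor coefficients at a diagonal point `(x,x)` of the
crossing terms `F^{s}_σ[x^a y^b + x^b y^a]` through boot-1's factor germs `factorᵢGerm s α x m`. The
certificates of record sit at `x = 1/2`, where boot-1's `TaylorCoeffZMonoHalf` already collapses both
factor germs to binomial polynomials: `factor₁Germ s α (1/2) m = (1/2)^s (1/2)^α 2^m · q¹(s,α;m)`,
`factor₂Germ … = … q²(s,α;m)` with `qFactor₁ s α m = ∑_{i+i'=m} (-1)^i C(s,i) C(α,i')`
(`C = Ring.choose`, a polynomial in `α` of degree `m`), and `TaylorQPolyParity.qFactor₂_eq` gives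
`q² = (-1)^m q¹`. Here: `qFactor₁_zero_right` (`q¹(s,0;m) = (-1)^m C(s,m)`), and hence
(`taylorCoeffAt_half_crossF_pairPow`) for `b ≥ 0`, `J ∈ ℕ`:
  `T_{(m,n)}(F^{s}_{-1}[pairPow (b+J) b]) = (1 - (-1)^{m+n}) (1/2)^{s}(1/2)^{s} (1/2)^{b+J} (1/2)^b 2^{m+n}
      · (q¹_{b+J}(m) q¹_b(n) + q¹_b(m) q¹_{b+J}(n))`,
which VANISHES for `m + n` even (`taylorCoeffAt_half_eq_zero_of_even` — the antisymmetry of `F_-`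
under `(z,z̄) ↦ (1-z,1-z̄)`) and carries the factor `2` for `m + n` odd; and for the identity term
(`taylorCoeffAt_half_crossF_one`)
  `T_{(m,n)}(F^{s}_{-1}[1]) = (1 - (-1)^{m+n}) (1/2)^{2s} 2^{m+n} · (-1)^m C(s,m) · (-1)^n C(s,n)`.
Up to the positive factor `(1/2)^{2s+E}`, `E = 2b + J`, the bracket is the readers' polynomial object
`Q(E, j)` of `FORMAT deriv-functional-2d` (A: `Qa(E, j²)`; B: `TB(a,b)`): the region obligation of a
table `w` is `0 ≤ ∑_{(m,n)∈S} w_{mn} (1-(-1)^{m+n}) 2^{m+n} (q¹_a(m) q¹_b(n) + q¹_b(m) q¹_a(n))`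
for `a = b + J`, `b ≥ 0`, `2b + J ≥ E₀` — a polynomial inequality in `b` for each `J`
(`pairPositiveAbove_half_of_poly`).
Dictionary to the readers of record (checked symbolically, `KP1/README.md` §2): reader B's
`fa_m(D,a) = m! [x^m] (1-2x)^D (1+2x)^a = m! 2^m · qFactor₁ D a m` and `fb_m = (-1)^m fa_m`, so with the
table `w_{mn} = m! n! α_{mn}` one has `taylorFunctional2D (1/2) S w (F^{D}_{-1}[1]) = 4^{-D} TB(0,0)` and
`taylorFunctional2D (1/2) S w (F^{D}_{-1}[pairPow a b]) = 2 · 4^{-D} 2^{-(a+b)} TB(a,b)` — verifier B's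
(I) and (R) objects exactly (`verify_B2d.py` ≥ 2.0 docstring); reader A's `Qa(E, j²)` is the same
polynomial in the variables `E = a + b`, `j = a - b`.

Sources: boot-1's `TaylorCoeffZMono` / `TaylorCoeffZMonoHalf` / `TaylorQPolyParity` (`qFactor₁/₂`,
`factor₁Germ_half`, `factor₂Germ_half`, `qFactor₂_eq` — reused, not restated), this seat's
`Control2DTaylorClosedForm`;
Kos–Poland–Simmons-Duffin 2014 §3.3 (derivative functionals at the crossing-symmetric point).
-/

namespace Summit.CriticalPhenomena.Ising3D.Control2D

open Finset Set
open Literature.MathematicalPhysics.QuantumFieldTheory.ConformalBootstrap3D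

/-! ### One more fact about boot-1's binomial polynomial `qFactor₁` -/

/-- `q¹(s,0;m) = (-1)^m C(s,m)` (only `i = m` survives: `C(0, k) = 0` for `k ≥ 1`). [folklore] -/
theorem qFactor₁_zero_right (s : ℝ) (m : ℕ) : qFactor₁ s 0 m = (-1 : ℝ) ^ m * Ring.choose s m := by
  unfold qFactor₁
  rw [Finset.sum_eq_single_of_mem (m, 0) (by simp)]
  · rw [Ring.choose_zero_right, mul_one]
  · intro ij hij hne
    have hi : ij.1 + ij.2 = m := mem_antidiagonal.mp hij
    have h2 : ij.2 ≠ 0 := by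
      intro h0
      apply hne
      ext <;> simp <;> omega
    rw [Ring.choose_zero_pos ℝ (Nat.pos_of_ne_zero h2), mul_zero]

/-! ### The coefficients of the crossing terms at `(1/2, 1/2)` -/

/-- **The Taylor coefficients at `(1/2,1/2)` of `F^{s}_{-1}[pairPow (b+J) b]`, as binomial polynomials**
(`b ≥ 0`, `J ∈ ℕ`):
`T_{(m,n)} = (1 - (-1)^{m+n}) (1/2)^{2s} (1/2)^{b+J} (1/2)^b 2^{m+n} (q_{b+J}(m) q_b(n) + q_b(m) q_{b+J}(n))`,
`q_α(m) = qFactor₁ s α m`. [cite: KosPolandSimmonsduffin2014, §3.3 eq. (3.17)] -/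
theorem taylorCoeffAt_half_crossF_pairPow (s : ℝ) {b : ℝ} (hb : 0 ≤ b) (J : ℕ) (mn : ℕ × ℕ) :
    taylorCoeffAt (1 / 2) (1 / 2) mn (crossF s (-1) (pairPow (b + J) b)) =
      (1 - (-1 : ℝ) ^ (mn.1 + mn.2)) *
        ((1 / 2 : ℝ) ^ s * (1 / 2 : ℝ) ^ s * (1 / 2 : ℝ) ^ (b + J) * (1 / 2 : ℝ) ^ b *
          2 ^ (mn.1 + mn.2)) *
        (qFactor₁ s (b + J) mn.1 * qFactor₁ s b mn.2 + qFactor₁ s b mn.1 * qFactor₁ s (b + J) mn.2) := by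
  rw [taylorCoeffAt_crossF_pairPow (by norm_num) (by norm_num) s (-1) hb J mn]
  simp only [factor₁Germ_half, factor₂Germ_half, qFactor₂_eq, pow_add]
  ring

/-- **Even orders vanish**: for `m + n` even the coefficient is `0` (antisymmetry of `F_-` at the
crossing-symmetric point). [folklore] -/
theorem taylorCoeffAt_half_eq_zero_of_even (s : ℝ) {b : ℝ} (hb : 0 ≤ b) (J : ℕ) {mn : ℕ × ℕ}
    (he : Even (mn.1 + mn.2)) :
    taylorCoeffAt (1 / 2) (1 / 2) mn (crossF s (-1) (pairPow (b + J) b)) = 0 := by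
  rw [taylorCoeffAt_half_crossF_pairPow s hb J mn, he.neg_one_pow]
  ring

/-- **The identity term at `(1/2,1/2)`**:
`T_{(m,n)}(F^{s}_{-1}[1]) = (1 - (-1)^{m+n}) (1/2)^{2s} 2^{m+n} · (-1)^m C(s,m) · (-1)^n C(s,n)`
(from `taylorCoeffAt_crossF_one` and `qFactor₁_zero_right`). [folklore] -/
theorem taylorCoeffAt_half_crossF_one (s : ℝ) (mn : ℕ × ℕ) :
    taylorCoeffAt (1 / 2) (1 / 2) mn (crossF s (-1) (fun _ _ => (1 : ℝ))) =
      (1 - (-1 : ℝ) ^ (mn.1 + mn.2)) * ((1 / 2 : ℝ) ^ s * (1 / 2 : ℝ) ^ s * 2 ^ (mn.1 + mn.2)) *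
        (((-1 : ℝ) ^ mn.1 * Ring.choose s mn.1) * ((-1 : ℝ) ^ mn.2 * Ring.choose s mn.2)) := by
  rw [taylorCoeffAt_crossF_one (by norm_num) (by norm_num) s (-1) mn]
  simp only [factor₁Germ_half, factor₂Germ_half, qFactor₂_eq, qFactor₁_zero_right,
    Real.rpow_zero, pow_add]
  ring

/-- **The table functional at `(1/2,1/2)` on a pair-monomial crossing term** — the object of the
region obligation: a positive factor times
`∑_{p∈S} w_p (1 - (-1)^{p₁+p₂}) 2^{p₁+p₂} (q_{b+J}(p₁) q_b(p₂) + q_b(p₁) q_{b+J}(p₂))`. [folklore] -/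
theorem taylorFunctional2D_half_crossF_pairPow (S : Finset (ℕ × ℕ)) (w : ℕ × ℕ → ℝ) (s : ℝ)
    {b : ℝ} (hb : 0 ≤ b) (J : ℕ) :
    taylorFunctional2D (1 / 2) S w (crossF s (-1) (pairPow (b + J) b)) =
      ((1 / 2 : ℝ) ^ s * (1 / 2 : ℝ) ^ s * (1 / 2 : ℝ) ^ (b + J) * (1 / 2 : ℝ) ^ b) *
        ∑ p ∈ S, w p * ((1 - (-1 : ℝ) ^ (p.1 + p.2)) * 2 ^ (p.1 + p.2) *
          (qFactor₁ s (b + J) p.1 * qFactor₁ s b p.2 + qFactor₁ s b p.1 * qFactor₁ s (b + J) p.2)) := by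
  rw [taylorFunctional2D, LinearMap.sum_apply, Finset.mul_sum]
  refine Finset.sum_congr rfl fun p _ => ?_
  rw [LinearMap.smul_apply, smul_eq_mul, taylorCoeffAt_half_crossF_pairPow s hb J p]
  ring

/-- **Region obligation at `(1/2,1/2)`, polynomial form**: if for all `b ≥ 0`, `J ∈ ℕ` with
`2b + J ≥ E₀` the binomial-polynomial sum is `≥ 0`, then `PairPositiveAbove (taylorFunctional2D (1/2) S w) s E₀`
(the positive prefactor dropped; `pairPositiveAbove_of_nat`). [cite: RattazziEtAl2008, §5.5] -/
theorem pairPositiveAbove_half_of_poly (S : Finset (ℕ × ℕ)) (w : ℕ × ℕ → ℝ) {s E₀ : ℝ}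
    (h : ∀ (b : ℝ) (J : ℕ), 0 ≤ b → E₀ ≤ 2 * b + J →
      0 ≤ ∑ p ∈ S, w p * ((1 - (-1 : ℝ) ^ (p.1 + p.2)) * 2 ^ (p.1 + p.2) *
        (qFactor₁ s (b + J) p.1 * qFactor₁ s b p.2 + qFactor₁ s b p.1 * qFactor₁ s (b + J) p.2))) :
    PairPositiveAbove (taylorFunctional2D (1 / 2) S w) s E₀ := by
  refine pairPositiveAbove_of_nat fun b J hb hE => ?_
  rw [taylorFunctional2D_half_crossF_pairPow S w s hb J]
  refine mul_nonneg ?_ (h b J hb hE)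
  have h1 : (0 : ℝ) < (1 / 2 : ℝ) ^ s := Real.rpow_pos_of_pos (by norm_num) s
  have h2 : (0 : ℝ) < (1 / 2 : ℝ) ^ (b + J) := Real.rpow_pos_of_pos (by norm_num) _
  have h3 : (0 : ℝ) < (1 / 2 : ℝ) ^ b := Real.rpow_pos_of_pos (by norm_num) b
  positivity

end Summit.CriticalPhenomena.Ising3D.Control2D
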